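import Mathlib
import Summits.Ventures.PercRepro2.TypedHat
import Summits.Ventures.PercRepro2.TypedResidualCoreU
import Summits.Ventures.PercRepro2.K5TypedK3Marks

/-!
# The marked-hat class is closed: the crux of record from (TRI) on the core with an unmarked
vertex that is not a marked hat (blind cell PercRepro2, p2 g0, 2026-08-25; sub-claim S1; the
lead's ruling 04:33:25Z (1) «p2 takes (A)», mine-1's MINE1-J1.md §23.11)

A **marked hat** is an unmarked vertex whose typed edges are exactly three: to a mark `v ∉ {a₁, a₂}`,
to `a₁` and to `a₂` (`IsMarkedHat`). If every unmarked vertex touched by the typed set is a marked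
hat (`MarkedHats`), the hat rule (`typedCount_hat`) eliminates the hats one at a time — each
elimination re-maps the hat's edges to edges among the marks, so the remaining hats are untouched
and only parallels among marks are created — and the all-marked loop-free multigraph base is
typer-1's `K5.typedCount_K3_nonneg_multi`:

* **`typedCount_nonneg_of_markedHats`** — row 2′TRI on every loop-free typed graph with
  `MarksDistinct` marks whose unmarked typed vertices are all marked hats;
* **`ResidualCoreNH`** — the core with an unmarked typed vertex that is NOT a marked hat
  (`¬ MarkedHats`); **`HCov_all_of_residualCoreNH_all : ResidualCoreNH_all R → HCov_all R`** —
  UNCONDITIONAL: the crux of record from (TRI) on those instances. `ResidualCoreNH ⊆ ResidualCoreU`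
  (`ResidualCoreNH.coreU`).

Own code; standard axioms.
-/

namespace Summit.Ventures.PercRepro2

open UnionCluster

namespace CovForm

namespace TypedRed

/-! ## Marked hats -/

section Hats

variable {V : Type*} {E : Type*}
variable (ends : E → Sym2 V) (o a₁ a₂ a₃ b : V) (F : Finset E)

/-- `u` is a **marked hat**: its typed edges are exactly `e_v = u–v` with `v` a mark other than
the roots, `e₁ = u–a₁`, `e₂ = u–a₂`. -/
def IsMarkedHat (u : V) : Prop :=
  ∃ (v : V) (e_v e₁ e₂ : E), (v = o ∨ v = a₃ ∨ v = b) ∧ v ≠ a₁ ∧ v ≠ a₂ ∧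
    e_v ∈ F ∧ e₁ ∈ F ∧ e₂ ∈ F ∧ e_v ≠ e₁ ∧ e_v ≠ e₂ ∧ e₁ ≠ e₂ ∧
    ends e_v = s(u, v) ∧ ends e₁ = s(u, a₁) ∧ ends e₂ = s(u, a₂) ∧
    ∀ e ∈ F, u ∈ ends e → e = e_v ∨ e = e₁ ∨ e = e₂

/-- Every unmarked vertex touched by a typed edge is a marked hat. -/
def MarkedHats : Prop :=
  ∀ u, u ≠ o → u ≠ a₁ → u ≠ a₂ → u ≠ a₃ → u ≠ b → (∃ e ∈ F, u ∈ ends e) →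
    IsMarkedHat ends o a₁ a₂ a₃ b F u

/-- An all-marked typed set has no unmarked typed vertex, hence `MarkedHats` vacuously. -/
theorem markedHats_of_allMarked (h : AllMarked ends o a₁ a₂ a₃ b F) :
    MarkedHats ends o a₁ a₂ a₃ b F := by
  intro u huo hu1 hu2 hu3 hub ⟨e, he, hue⟩
  rcases h e he u hue with h' | h' | h' | h' | h'
  · exact absurd h' huo
  · exact absurd h' hu1
  · exact absurd h' hu2
  · exact absurd h' hu3
  · exact absurd h' hub

end Hats

/-! ## Eliminating the hats -/

section Elimination

variable {V : Type*} {E : Type*} [DecidableEq V] [Fintype E] [DecidableEq E]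
variable {R : Type*} [Field R] [LinearOrder R] [IsStrictOrderedRing R]

/-- **Row 2′TRI on the marked-hat class**: marks `MarksDistinct`, the typed set loop-free, mixed
types on every typed edge with an unmarked end, every unmarked typed vertex a marked hat. Induction
on `|F|`: eliminate a hat by `typedCount_hat`; the all-marked base is typer-1's
`K5.typedCount_K3_nonneg_multi`. -/
theorem typedCount_nonneg_of_markedHats :
    ∀ (F : Finset E) (ends : E → Sym2 V) (o a₁ a₂ a₃ b : V) (τ : E → ℕ),
      MarksDistinct o a₁ a₂ a₃ b → (∀ e ∈ F, ¬ (ends e).IsDiag) →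
      (∀ e ∈ F, (∃ p ∈ ends e, p ≠ o ∧ p ≠ a₁ ∧ p ≠ a₂ ∧ p ≠ a₃ ∧ p ≠ b) → τ e = 1 ∨ τ e = 2) →
      MarkedHats ends o a₁ a₂ a₃ b F →
      0 ≤ typedCount F (fun _ => false) τ
        (K3 ends o a₁ a₂ a₃ b : Config E → Config E → Config E → R) := by
  intro F
  induction' hn : F.card using Nat.strong_induction_on with n ih generalizing F
  intro ends o a₁ a₂ a₃ b τ hm hloop hτ hhats
  by_cases hall : AllMarked ends o a₁ a₂ a₃ b F
  · exact K5.typedCount_K3_nonneg_multi ends hm.1.1 hm.1.2.1 hm.1.2.2.1 hm.1.2.2.2.1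
      hm.1.2.2.2.2.1 hm.1.2.2.2.2.2.1 hm.1.2.2.2.2.2.2 hm.2 F τ hloop hall
  -- an unmarked typed vertex, hence a marked hat
  obtain ⟨e₀, he₀, u, hu₀, huo, hu1, hu2, hu3, hub⟩ := exists_unmarked_of_not_allMarked hall
  obtain ⟨v, e_v, e₁, e₂, hvm, hv1, hv2, hvF, h1F, h2F, hev1, hev2, he12, hv, h1, h2, honly⟩ :=
    hhats u huo hu1 hu2 hu3 hub ⟨e₀, he₀, hu₀⟩
  have huv : u ≠ v := by
    rcases hvm with rfl | rfl | rfl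
    · exact huo
    · exact hu3
    · exact hub
  -- the hat rule
  have hcl : ∀ e, u ∈ ends e → e ≠ e_v → e ≠ e₁ → e ≠ e₂ →
      e ∉ F ∧ (fun _ : E => false) e = false := by
    intro e hue h₁ h₂ h₃
    refine ⟨fun heF => ?_, rfl⟩
    rcases honly e heF hue with h | h | h
    · exact h₁ h
    · exact h₂ h
    · exact h₃ h
  have hzz : Function.update (fun _ : E => false) e₂ false = fun _ => false := by
    funext e
    simp only [Function.update_apply]
    split_ifs <;> rfl
  rw [typedCount_hat ends o a₁ a₂ a₃ b hv h1 h2 hev1 hev2 he12 huo hu1 hu2 hu3 hub F hvF h1F h2F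
    (fun _ => false) hcl τ (hτ e_v hvF ⟨u, by rw [hv]; exact Sym2.mem_mk_left _ _, huo, hu1, hu2, hu3, hub⟩)
    (hτ e₁ h1F ⟨u, by rw [h1]; exact Sym2.mem_mk_left _ _, huo, hu1, hu2, hu3, hub⟩)
    (hτ e₂ h2F ⟨u, by rw [h2]; exact Sym2.mem_mk_left _ _, huo, hu1, hu2, hu3, hub⟩), hzz]
  -- every term is nonnegative by the induction hypothesis
  refine Finset.sum_nonneg fun t₁ _ => Finset.sum_nonneg fun t₂ _ => mul_nonneg (Nat.cast_nonneg _) ?_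
  set ends' := hatEnds ends e_v e₁ v a₁ a₂ with hends'
  have hcard : (F.erase e₂).card < n := hn ▸ Finset.card_erase_lt_of_mem h2F
  -- the re-mapped edges are among the marks
  have hmark_v : v = o ∨ v = a₁ ∨ v = a₂ ∨ v = a₃ ∨ v = b := by
    rcases hvm with h | h | h
    · exact Or.inl h
    · exact Or.inr (Or.inr (Or.inr (Or.inl h)))
    · exact Or.inr (Or.inr (Or.inr (Or.inr h)))
  have hends'_marks : ∀ e, e = e_v ∨ e = e₁ → ∀ p ∈ ends' e, p = o ∨ p = a₁ ∨ p = a₂ ∨ p = a₃ ∨ p = b := by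
    intro e he p hp
    rcases he with rfl | rfl
    · rw [hends', hatEnds_ev hev1] at hp
      rcases Sym2.mem_iff.1 hp with rfl | rfl
      · exact hmark_v
      · exact Or.inr (Or.inl rfl)
    · rw [hends', hatEnds_e1] at hp
      rcases Sym2.mem_iff.1 hp with rfl | rfl
      · exact hmark_v
      · exact Or.inr (Or.inr (Or.inl rfl))
  have hother : ∀ e, e ≠ e_v → e ≠ e₁ → ends' e = ends e := fun e h₁ h₂ => by
    rw [hends', hatEnds_other h₁ h₂]
  refine ih _ hcard (F.erase e₂) rfl ends' o a₁ a₂ a₃ b _ hm ?_ ?_ ?_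
  · -- loop-free
    intro e he
    by_cases hev : e = e_v
    · subst hev
      rw [hends', hatEnds_ev hev1, Sym2.mk_isDiag_iff]
      exact hv1
    by_cases he1 : e = e₁
    · subst he1
      rw [hends', hatEnds_e1, Sym2.mk_isDiag_iff]
      exact hv2
    rw [hother e hev he1]
    exact hloop e (Finset.mem_of_mem_erase he)
  · -- mixed types on the edges with an unmarked end
    intro e he ⟨p, hp, hpo, hp1, hp2, hp3, hpb⟩
    by_cases hev : e = e_v
    · exfalso
      rcases hends'_marks e (Or.inl hev) p hp with h | h | h | h | h
      · exact hpo h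
      · exact hp1 h
      · exact hp2 h
      · exact hp3 h
      · exact hpb h
    by_cases he1 : e = e₁
    · exfalso
      rcases hends'_marks e (Or.inr he1) p hp with h | h | h | h | h
      · exact hpo h
      · exact hp1 h
      · exact hp2 h
      · exact hp3 h
      · exact hpb h
    rw [Function.update_of_ne he1, Function.update_of_ne hev]
    exact hτ e (Finset.mem_of_mem_erase he) ⟨p, by rwa [hother e hev he1] at hp, hpo, hp1, hp2, hp3, hpb⟩
  · -- every unmarked typed vertex is still a marked hat
    intro w hwo hw1 hw2 hw3 hwb ⟨e, he, hwe⟩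
    -- the edge `e` is not a re-mapped one
    have hev : e ≠ e_v := fun h => by
      rcases hends'_marks e (Or.inl h) w hwe with h' | h' | h' | h' | h'
      · exact hwo h'
      · exact hw1 h'
      · exact hw2 h'
      · exact hw3 h'
      · exact hwb h'
    have he1 : e ≠ e₁ := fun h => by
      rcases hends'_marks e (Or.inr h) w hwe with h' | h' | h' | h' | h'
      · exact hwo h'
      · exact hw1 h'
      · exact hw2 h'
      · exact hw3 h'
      · exact hwb h'
    have he2 : e ≠ e₂ := (Finset.mem_erase.1 he).1
    rw [hother e hev he1] at hwe
    -- `w ≠ u`: `u` is no longer typed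
    have hwu : w ≠ u := fun h => by
      subst h
      rcases honly e (Finset.mem_of_mem_erase he) hwe with h' | h' | h'
      · exact hev h'
      · exact he1 h'
      · exact he2 h'
    obtain ⟨v', f_v, f₁, f₂, hv'm, hv'1, hv'2, hfvF, hf1F, hf2F, hf1, hf2, hf12, hfv, hfe1, hfe2,
      honly'⟩ := hhats w hwo hw1 hw2 hw3 hwb ⟨e, Finset.mem_of_mem_erase he, hwe⟩
    -- the edges of the hat `w` are not the edges of the hat `u`
    have hwv : w ≠ v := by
      rcases hvm with rfl | rfl | rfl
      · exact hwo
      · exact hw3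
      · exact hwb
    have hne : ∀ f, ends f = s(w, v') ∨ ends f = s(w, a₁) ∨ ends f = s(w, a₂) →
        f ≠ e_v ∧ f ≠ e₁ ∧ f ≠ e₂ := by
      intro f hf
      have hwf : w ∈ ends f := by
        rcases hf with h | h | h <;> rw [h] <;> exact Sym2.mem_mk_left _ _
      refine ⟨fun h => ?_, fun h => ?_, fun h => ?_⟩
      · rw [h, hv] at hwf
        rcases Sym2.mem_iff.1 hwf with h' | h'
        · exact hwu h'
        · exact hwv h'
      · rw [h, h1] at hwf
        rcases Sym2.mem_iff.1 hwf with h' | h'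
        · exact hwu h'
        · exact hw1 h'
      · rw [h, h2] at hwf
        rcases Sym2.mem_iff.1 hwf with h' | h'
        · exact hwu h'
        · exact hw2 h'
    obtain ⟨hfv_v, hfv_1, hfv_2⟩ := hne f_v (Or.inl hfv)
    obtain ⟨hf1_v, hf1_1, hf1_2⟩ := hne f₁ (Or.inr (Or.inl hfe1))
    obtain ⟨hf2_v, hf2_1, hf2_2⟩ := hne f₂ (Or.inr (Or.inr hfe2))
    refine ⟨v', f_v, f₁, f₂, hv'm, hv'1, hv'2, Finset.mem_erase.2 ⟨hfv_2, hfvF⟩,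
      Finset.mem_erase.2 ⟨hf1_2, hf1F⟩, Finset.mem_erase.2 ⟨hf2_2, hf2F⟩, hf1, hf2, hf12,
      by rw [hother f_v hfv_v hfv_1]; exact hfv, by rw [hother f₁ hf1_v hf1_1]; exact hfe1,
      by rw [hother f₂ hf2_v hf2_1]; exact hfe2, ?_⟩
    intro g hg hwg
    have hgv : g ≠ e_v := fun h => by
      rcases hends'_marks g (Or.inl h) w hwg with h' | h' | h' | h' | h'
      · exact hwo h'
      · exact hw1 h'
      · exact hw2 h'
      · exact hw3 h'
      · exact hwb h'
    have hg1 : g ≠ e₁ := fun h => by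
      rcases hends'_marks g (Or.inr h) w hwg with h' | h' | h' | h' | h'
      · exact hwo h'
      · exact hw1 h'
      · exact hw2 h'
      · exact hw3 h'
      · exact hwb h'
    rw [hother g hgv hg1] at hwg
    exact honly' g (Finset.mem_of_mem_erase hg) hwg

end Elimination

/-! ## The conjunct in the core -/

section Core

variable {V : Type*} {E : Type*} [DecidableEq V] [Fintype E] [DecidableEq E]

/-- **The core with an unmarked typed vertex that is not a marked hat.** -/
structure ResidualCoreNH (ends : E → Sym2 V) (o a₁ a₂ a₃ b : V) (F : Finset E) : Prop where
  core : ResidualCore ends o a₁ a₂ a₃ b F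
  not_hats : ¬ MarkedHats ends o a₁ a₂ a₃ b F

omit [DecidableEq V] [Fintype E] in
/-- `ResidualCoreNH ⊆ ResidualCoreU`. -/
theorem ResidualCoreNH.coreU {ends : E → Sym2 V} {o a₁ a₂ a₃ b : V} {F : Finset E}
    (h : ResidualCoreNH ends o a₁ a₂ a₃ b F) : ResidualCoreU ends o a₁ a₂ a₃ b F :=
  ⟨h.core, exists_unmarked_of_not_allMarked fun hall =>
    h.not_hats (markedHats_of_allMarked ends o a₁ a₂ a₃ b F hall)⟩

end Core

section Closure

variable (R : Type*) [Field R] [LinearOrder R] [IsStrictOrderedRing R]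

/-- **Row 2′TRI on `ResidualCoreNH`, over every finite graph.** -/
def ResidualCoreNH_all : Prop :=
  ∀ (V E : Type) [Fintype V] [DecidableEq V] [Fintype E] [DecidableEq E]
    (ends : E → Sym2 V) (o a₁ a₂ a₃ b : V) (F : Finset E) (τ : E → ℕ),
    (∀ e ∈ F, τ e = 1 ∨ τ e = 2) → ResidualCoreNH ends o a₁ a₂ a₃ b F →
      0 ≤ typedCount F (fun _ => false) τ
        (K3 ends o a₁ a₂ a₃ b : Config E → Config E → Config E → R)

/-- **THE CRUX OF RECORD FROM (TRI) ON THE CORE INSTANCES WITH AN UNMARKED TYPED VERTEX THAT IS NOT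
A MARKED HAT** — unconditional: the marked-hat instances are the hat rule over typer-1's `K₅`
multigraph theorem. -/
theorem HCov_all_of_residualCoreNH_all (hc : ResidualCoreNH_all R) : HCov_all R := by
  refine HCov_all_of_residualCore_all R ?_
  intro V E _ _ _ _ ends o a₁ a₂ a₃ b F τ hτ hcore
  by_cases hh : MarkedHats ends o a₁ a₂ a₃ b F
  · exact typedCount_nonneg_of_markedHats F ends o a₁ a₂ a₃ b τ hcore.marks
      hcore.residualConR.residualCon.residual.reduced.no_loop (fun e he _ => hτ e he) hh
  · exact hc V E ends o a₁ a₂ a₃ b F τ hτ ⟨hcore, hh⟩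

end Closure

end TypedRed

end CovForm

end Summit.Ventures.PercRepro2
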